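import Summits.AtomisticToContinuum.Crystallization.Theorems.FrustratedLawDichotomyStrainedPatchKernelCutSector

/-!
(SPLIT FOR THE 400-LINE CAP by the landing lane, hand-2 g42: this file = part 1 of 2; sequels `…FrustratedLawDichotomyStrainedPatchShearDoor` import it in a chain; same namespace, all FQNs unchanged.)
# Strained patch — «ShearDoor»: the SHEAR-AWARE door 𝓡′ of SECTOR-95 TYPED on the generating datum of the host (Gram window, per pattern branch),
# and the FOUR-SECTOR cut (the band 𝔅 re-dialled at a density threshold) — lens-5 g97, critic rows 1588 (A)(iii) / 1589 (B) / 1590 (E);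
# EDITION 2 (lens-5 g98, critic row 1599 repair (a)): the BENDING CLASS `𝓑` of the door's bent-homogeneous presentation is a PARAMETER of the door

WHAT DIED (g96/g46): «DOOR-STIFF-95» as posed — `Λ₀ ≥ 1` on `Door (24/25) (9/100)` — is DEAD: census STIFF46 (rev 3) measures the clamped `63/10`-ball
Hessian coercivity `Λ₀` of homogeneous fcc hosts at nearest-neighbour distance `24/25` falling from `1.466` (isotropic) to `0.27` along the softest
(trigonal, `[111]`) shear INSIDE that door (`Λ₀ = 1` crossed at off-diagonal strain `e ≈ 0.0112`, tree misfit `η ≈ 0.028`), and below `1` on PROLATE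
diagonal hosts too (uniaxial `c/a = 1.08`: `0.785`; orthorhombic `(1.05, .95, 1)`: `0.827`; `(1.07, .93, 1)`: `0.632`), while OBLATE tetragonal hosts stay
stiff (Bain `(1.05, 1.05, .95)`: `1.142`; biaxial `(1, 1.06, 1.06)`: `1.262`).  Critic r1590 (E): the door must be SHEAR-AWARE, not globally narrowed; the
literal and the norm on the deviatoric part are the lens's to choose; `Door (24/25) (1/36)` isotropic-narrow is the documented fallback.

WHAT THIS FILE TYPES (defs are PREDICATES ONLY; every literal is a parameter; the instance line is separate — memo NODE-g97 §3):
* §0 `gramE G a b = ⟪G e_a, G e_b⟫` — the Gram entries of the host's GENERATING map `G` in the pattern frame (cubic = the frame of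
  `FlatleyTheil2015.fccVec` for the fcc branch of `IsHomBall`; hexagonal Cartesian, `c ∥ e₃`, = the frame of `hexFrame` for the hcp branch);
  `GramWindow d₁ ν μ δ G` — (V) VOLUME `Σ_a γ_aa ≤ 3((1+ν)d₁)²` (RMS first-shell radius `≤ (1+ν)d₁`: `Σ_shell u uᵀ = 4·I` for both patterns), (D) SINGLE-AXIS
  DILATION `γ_aa ≤ ((1+μ)d₁)²` (tetragonal / orthorhombic / `c/a` part, SIGNED: compression is free, only dilation is capped — STIFF46: oblate hosts are stiff,
  prolate ones soft, FINDING «PROLATE-97»), (S) OFF-DIAGONAL `|γ_ab| ≤ δ d₁²` (`a ≠ b`; the trigonal / `C₄₄`-type shear — the `1/36`-class part of r1590 (E));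
  the isotropic host `G = d·1`, `d ≤ (1+ν)d₁, (1+μ)d₁`, is in the window (`gramWindow_smul_one`: non-vacuity), the dilated one is not
  (`not_gramWindow_smul_one_of_lt`), the window is monotone in `(ν, μ, δ)`.
* §1 `IsWindowBall Wf Wh 𝓑 R` — `IsBentBall 𝓑 R` with the generating `G` EXPOSED and constrained PER BRANCH (`Wf G` on the fcc branch, `Wh G` on the hcp
  branch; EXISTENTIAL over presentations, so a census over window boxes in `(G, ξ, b)` covers it; trivial windows give back `IsBentBall` exactly:
  `isBentBall_of_isWindowBall` / `isWindowBall_top_of_isBentBall`); ★ `ShearDoor d₁ η 𝓑 Wf Wh := Door d₁ η ∧ IsWindowBall Wf Wh 𝓑 (133/10)` — a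
  SUB-FAMILY of the g95 door (`shearDoor_le_door`), so EVERY sector theorem of …StiffDoor / …KernelCutSector applies to `𝓡 := ShearDoor …` verbatim, the
  old band sits inside the new band (`band_le_shearBand`), and the record-side reading `door ⟹ Stiff ∨ Deep` is inherited (`shearDoor_le_recordSide`);
  EDITION 2: the bending class `𝓑` (edition 1: hard-wired `bends0 = polyBends (1/200) (1/2000)`) is a PARAMETER — critic row 1599 «BENT-STIFF-97»: the
  window constrains `G` (the strain AT THE CENTRE) and nothing constrains the bending `b` beyond `𝓑`, whose local gradient `‖Db(v) − 1‖ ≤ 2q₂|v| + 3q₃|v|²`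
  reaches `4–6 %` on the shells carrying the soft mode, so «DOOR-STIFF» over `bends0` is AT RISK at the thin window corners; with `𝓑` a parameter the
  post-census narrowing to `polyBends q₂′ q₃′` is an INSTANCE change (the door is MONOTONE in `𝓑`: `isWindowBall_mono_bends`, `shearDoor_mono_bends`;
  hosts evicted by a narrower `𝓑` join the band: `shearBand_anti_bends`; «DOOR-STIFF» is ANTITONE in `𝓑`: `doorStiff_anti_bends`), not a third door file;
  the record SHAPE `ShearDoorGram d₁ η 𝓑 ν μ δ νh μh δh := ShearDoor d₁ η 𝓑 (GramWindow d₁ ν μ δ) (GramWindow d₁ νh μh δh)` (separate hcp literals: the fcc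
  soft trigonal mode is the hexagonal `c/a` mode, a DIAGONAL (axis-3) dilation in the hcp frame, so `μh` is `δ`-class — no hcp stiffness data exist yet,
  census row «STIFF-HCP-97»).  «DOOR-STIFF-97» (census, CERTIFICATE · INSTRUMENTABLE) is the Prop `FamilyLE (famAnd FamP (ShearDoorGram (24/25) (9/100) 𝓑 ν μ
  δ νh μh δh)) (Stiff hessBlk0 (63/10) Λ₀)` at the instance literals (bending class `𝓑 = bends0` or the census-narrowed `polyBends q₂′ q₃′`, row
  «STIFF-BENT-97»); it is ANTITONE in the window (`doorStiff_anti_window`) and in `𝓑` (`doorStiff_anti_bends`).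
* §2 THE FOUR-SECTOR CUT (critic r1589 (B): the band re-dialled at a density threshold `dB`, record `1009/1000` = the certified BAND witness D at
  `d = 1.0092`): 𝔇 = dense ∧ `𝓡`, 𝔅lo = dense ∧ `¬𝓡` ∧ `Dense dB`, 𝔅hi = dense ∧ `¬𝓡` ∧ `¬Dense dB`, 𝔄 = dilated; ONE dense-side table
  `relConeBy 2 (stepByF 𝓡 βf₁ (stepByF (Dense dB) βf₂ βf₃)) (stepByF 𝓡 sf₁ (stepByF (Dense dB) sf₂ sf₃)) (1/25)` — every functional GENERIC (critic r1588
  (A)(iii): no slope literal before the census pair HTN-LP envelope × E-CONE-𝔇 is in): (N|𝔅) ⟸ (N|𝔅lo) ∧ (N|𝔅hi) at the common table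
  (`refineGB_band_of_two`), (E|𝔅) ⟸ (E|𝔅lo)(cone 2) ∧ (E|𝔅hi)(cone 3) (`tubeFloorGB_band_of_two`), the kernel-cut instrument on 𝔅lo reads its own cone
  (`pairKernelCert_bandLo_glued`, `refineGB_NBlo_of_kernelCut_top`), and ★★★ the crux BY NAME from the EIGHT cells
  (`aperiodicFrustratedLawGap_of_fourSector_A35000_T26_record`; kernel-cut form of (N|𝔇) `…_kernelCut_…`); §3 the record instance
  `𝓡 := ShearDoorGram (24/25) (9/100) bends0 …` (bending class of record `bends0`), `dA = 26/25`, `dB = 1009/1000` (`…_shearDoor_record`).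
Every piece is strictly weaker than its parent ((N|𝔅) ⟹ each restriction: `refineGB_iff_two_sectors`; the E-cells restrict from the glued cell).
[formal bookkeeping] 0 sorry · no new axioms · no cite tokens · no instances / notation.
-/

open scoped BigOperators Classical RealInnerProductSpace
open Summit.AtomisticToContinuum.Crystallization.Theorems.ChargedEnergyGapNegative (eStar E3)
open Summit.AtomisticToContinuum.Crystallization.Theorems.FrustratedLawDichotomyRangeCut
open Summit.AtomisticToContinuum.Crystallization.Theorems.FrustratedLawDichotomySchurCut
open Summit.AtomisticToContinuum.Crystallization.Theorems.FrustratedLawDichotomyMotifLemmas (GoodAtScale)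
open Summit.AtomisticToContinuum.Crystallization.Theorems.FrustratedLawDichotomyAveragingCut (ballAvg)
open Summit.AtomisticToContinuum.Crystallization.Theorems.FrustratedLawDichotomyExemptLocOpt (LocOptFails)
open Summit.AtomisticToContinuum.Crystallization.Theorems.FrustratedLawDichotomyExemptSplit (SchurElasticPricingX)
open Summit.AtomisticToContinuum.Crystallization.Theorems.FrustratedLawDichotomyExemptAbsorptionRecord
open Summit.AtomisticToContinuum.Crystallization.Theorems.FrustratedLawDichotomyCollarCensus
open Summit.AtomisticToContinuum.Crystallization.Theorems.FrustratedLawDichotomyCollarCensusKappa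
open Summit.AtomisticToContinuum.Crystallization.Theorems.FrustratedLawDichotomyStrainedPatchHomSplit
open Summit.AtomisticToContinuum.Crystallization.Theorems.FrustratedLawDichotomyStrainedPatchCleanCollar (CleanBall TailPenalty AnnularDefectFloor
  DefectiveCollarFloor tailOut)
open Summit.AtomisticToContinuum.Crystallization.Theorems.FrustratedLawDichotomyStrainedPatchPhaseCut (MonoPhaseBall AnnularPhaseFloor PolyTextureFloor)
open Summit.AtomisticToContinuum.Crystallization.Theorems.FrustratedLawDichotomyStrainedPatchCoreTube (NearHomIsoAt CoreOffTubeFloor)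
open Summit.AtomisticToContinuum.Crystallization.Theorems.FrustratedLawDichotomyStrainedPatchCoreTubeRecord (CoreCoreRelief)
open Summit.AtomisticToContinuum.Crystallization.Theorems.FrustratedLawDichotomyStrainedPatchChartFamilies (ChartBy FamilyLE familyLE_refl)
open Summit.AtomisticToContinuum.Crystallization.Theorems.FrustratedLawDichotomyStrainedPatchChartFamiliesBent (IsBentBall)
open Summit.AtomisticToContinuum.Crystallization.Theorems.FrustratedLawDichotomyStrainedPatchChartFamiliesPinned (bends0)
open Summit.AtomisticToContinuum.Crystallization.Theorems.FrustratedLawDichotomyStrainedPatchQuantSlaving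
open Summit.AtomisticToContinuum.Crystallization.Theorems.FrustratedLawDichotomyStrainedPatchHostCells (TubeFloor FamP)
open Summit.AtomisticToContinuum.Crystallization.Theorems.FrustratedLawDichotomyStrainedPatchGradedTube
open Summit.AtomisticToContinuum.Crystallization.Theorems.FrustratedLawDichotomyStrainedPatchCoverBridge
open Summit.AtomisticToContinuum.Crystallization.Theorems.FrustratedLawDichotomyStrainedPatchPairTube
open Summit.AtomisticToContinuum.Crystallization.Theorems.FrustratedLawDichotomyStrainedPatchKernelCut
open Summit.AtomisticToContinuum.Crystallization.Theorems.FrustratedLawDichotomyStrainedPatchHomCertTree (CertTree treeOK)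
open Summit.AtomisticToContinuum.Crystallization.Theorems.FrustratedLawDichotomyStrainedPatchHomEntryGram (rootC rootW)
open Summit.AtomisticToContinuum.Crystallization.Theorems.FrustratedLawDichotomyStrainedPatchHomEntryGramHcp (rootCH rootWH)
open Summit.AtomisticToContinuum.Crystallization.Theorems.FrustratedLawDichotomyStrainedPatchHomEntryLeafHT (entryLeafOK6RBKP4 semOKH)
open Summit.AtomisticToContinuum.Crystallization.Theorems.FrustratedLawDichotomyAperiodicGapRecordJunctionHomFloorF6pT26
open Summit.AtomisticToContinuum.Crystallization.Theorems.FrustratedLawDichotomyStrainedPatchConeAnatomy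
open Summit.AtomisticToContinuum.Crystallization.Theorems.FrustratedLawDichotomyStrainedPatchStiffSector
open Summit.AtomisticToContinuum.Crystallization.Theorems.FrustratedLawDichotomyStrainedPatchStiffDoor
open Summit.AtomisticToContinuum.Crystallization.Theorems.FrustratedLawDichotomyStrainedPatchKernelCutSector

namespace Summit.AtomisticToContinuum.Crystallization.Theorems.FrustratedLawDichotomyStrainedPatchShearDoor

/-! ## §0. The Gram window on the generating datum (every literal a parameter) -/

section Gram

/-- **`gramE G a b = ⟪G e_a, G e_b⟫`** — the Gram entry of the generating map `G` in the pattern frame (`e_a = EuclideanSpace.single a 1`: the cubic frame of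
`FlatleyTheil2015.fccVec` on the fcc branch, the hexagonal Cartesian frame of `hexFrame` on the hcp branch).  Rotation-blind (`G ↦ R ∘ G` leaves it fixed). -/
noncomputable def gramE (G : E3 →L[ℝ] E3) (a b : Fin 3) : ℝ :=
  ⟪G (EuclideanSpace.single a (1 : ℝ)), G (EuclideanSpace.single b (1 : ℝ))⟫

/-- (piece) [route statement · this cell; NOT a literature fact] **`GramWindow d₁ ν μ δ G`** — the SHEAR-AWARE strain window of the door, read on the Gram
data of `G` at the door's density scale `d₁`: (V) `Σ_a γ_aa ≤ 3((1+ν)d₁)²` (mean dilation / RMS shell radius `≤ (1+ν)d₁`), (D) `γ_aa ≤ ((1+μ)d₁)²` (every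
frame axis dilated by at most `μ`; compression free), (S) `|γ_ab| ≤ δ·d₁²` for `a ≠ b` (off-diagonal shear).  STIFF46 (nearest neighbour pinned at `24/25`):
`Λ₀ = 1` is crossed on the (S)-line (trigonal) at `|γ_ab|/d₁² ≈ 0.023` (where `m_V ≈ 1.011`), on the (D)-line (one axis dilated) near `5 %`, and the
penalties add; the instance literals of memo §3 sit inside every crossing with the table's soft hosts all OUTSIDE (`num/window97.out`). -/
def GramWindow (d₁ ν μ δ : ℝ) (G : E3 →L[ℝ] E3) : Prop :=
  (∑ a, gramE G a a ≤ 3 * ((1 + ν) * d₁) ^ 2) ∧ (∀ a, gramE G a a ≤ ((1 + μ) * d₁) ^ 2) ∧ ∀ a b, a ≠ b → |gramE G a b| ≤ δ * d₁ ^ 2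

/-- The Gram entries of the ISOTROPIC generating map `d·1`: `d²` on the diagonal, `0` off it. [formal bookkeeping] -/
theorem gramE_smul_one (d : ℝ) (a b : Fin 3) : gramE (d • (1 : E3 →L[ℝ] E3)) a b = if a = b then d ^ 2 else 0 := by
  unfold gramE
  have h1 : ∀ x : E3, (d • (1 : E3 →L[ℝ] E3)) x = d • x := fun _ => rfl
  rw [h1, h1, real_inner_smul_left, real_inner_smul_right, EuclideanSpace.inner_single_left, map_one, one_mul]
  have : (EuclideanSpace.single b (1 : ℝ) : E3) a = if a = b then 1 else 0 := by simp [PiLp.single_apply]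
  rw [this]
  split_ifs <;> ring

/-- ★ NON-VACUITY: the isotropic host `G = d·1` with `d² ≤ ((1+ν)d₁)²`, `d² ≤ ((1+μ)d₁)²` is in the window for every `δ ≥ 0` (so the compressed isotropic
fcc/hcp hosts of the g95 door, `d ≤ 24/25`, stay in the shear-aware door). [formal bookkeeping] -/
theorem gramWindow_smul_one {d₁ ν μ δ d : ℝ} (hδ : 0 ≤ δ) (hV : d ^ 2 ≤ ((1 + ν) * d₁) ^ 2) (hD : d ^ 2 ≤ ((1 + μ) * d₁) ^ 2) :
    GramWindow d₁ ν μ δ (d • (1 : E3 →L[ℝ] E3)) := by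
  refine ⟨?_, fun a => ?_, fun a b hab => ?_⟩
  · simp only [gramE_smul_one, if_true, Finset.sum_const, Finset.card_univ, Fintype.card_fin, nsmul_eq_mul, Nat.cast_ofNat]
    linarith
  · simp only [gramE_smul_one, if_true]
    exact hD
  · simp only [gramE_smul_one, if_neg hab, abs_zero]
    exact mul_nonneg hδ (sq_nonneg _)

/-- … and EXCLUSION: the isotropic host DILATED past the (V)-radius, `((1+ν)d₁)² < d²`, is NOT in the window — clause (V) bites even on scalar hosts
((T)/(S) bite on non-scalar ones: census side). [formal bookkeeping] -/
theorem not_gramWindow_smul_one_of_lt {d₁ ν μ δ d : ℝ} (hd : ((1 + ν) * d₁) ^ 2 < d ^ 2) : ¬GramWindow d₁ ν μ δ (d • (1 : E3 →L[ℝ] E3)) := by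
  rintro ⟨hV, -, -⟩
  simp only [gramE_smul_one, if_true, Finset.sum_const, Finset.card_univ, Fintype.card_fin, nsmul_eq_mul, Nat.cast_ofNat] at hV
  linarith

/-- The window is MONOTONE in its three literals (`d₁ ≥ 0`, `ν, μ ≥ −1`). [formal bookkeeping] -/
theorem gramWindow_mono {d₁ ν ν' μ μ' δ δ' : ℝ} {G : E3 →L[ℝ] E3} (hd : 0 ≤ d₁) (hν₀ : -1 ≤ ν) (hμ₀ : -1 ≤ μ) (hν : ν ≤ ν') (hμ : μ ≤ μ') (hδ : δ ≤ δ')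
    (h : GramWindow d₁ ν μ δ G) : GramWindow d₁ ν' μ' δ' G := by
  obtain ⟨hV, hD, hS⟩ := h
  have h0 : 0 ≤ (1 + ν) * d₁ := mul_nonneg (by linarith) hd
  have h1 : (1 + ν) * d₁ ≤ (1 + ν') * d₁ := mul_le_mul_of_nonneg_right (by linarith) hd
  have h0' : 0 ≤ (1 + μ) * d₁ := mul_nonneg (by linarith) hd
  have h1' : (1 + μ) * d₁ ≤ (1 + μ') * d₁ := mul_le_mul_of_nonneg_right (by linarith) hd
  refine ⟨hV.trans ?_, fun a => (hD a).trans (pow_le_pow_left₀ h0' h1' 2), fun a b hab => (hS a b hab).trans (mul_le_mul_of_nonneg_right hδ (sq_nonneg _))⟩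
  nlinarith [pow_le_pow_left₀ h0 h1 2]

end Gram

/-! ## §1. The bent-homogeneous presentation with the generating map EXPOSED and windowed per branch; the shear-aware door -/

section Door

/-- **`IsWindowBall Wf Wh 𝓑 R z₁ c₁`** — the text of `IsBentBall 𝓑 R` ∘ `IsHomBall R` with the generating map `G` (and hcp shuffle `ξ`) EXPOSED, the fcc
branch additionally requiring `Wf G`, the hcp branch `Wh G`.  Existential over presentations `(b, G, ξ)`: a host is windowed iff SOME presentation is. -/
def IsWindowBall (Wf Wh : (E3 →L[ℝ] E3) → Prop) (𝓑 : Set (E3 → E3)) (R : ℝ) {M : ℕ} (z₁ : Fin M → E3) (c₁ : Fin M) : Prop :=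
  ∃ (b : E3 → E3) (z₀ : Fin M → E3) (G : E3 →L[ℝ] E3) (ξ : E3), b ∈ 𝓑 ∧ ‖G - 1‖ ≤ 1 / 4 ∧ ‖ξ‖ ≤ 1 / 4 ∧
    ((Set.range z₀ = {x | dist x (z₀ c₁) ≤ R ∧ ∃ a : Fin 3 → ℤ, x = z₀ c₁ + latPt G Literature.Barriers.AtomisticToContinuum.FlatleyTheil2015.fccVec a} ∧ Wf G) ∨
      (Set.range z₀ = {x | dist x (z₀ c₁) ≤ R ∧ ∃ a : Fin 3 → ℤ, x = z₀ c₁ + latPt G hexFrame a ∨ x = z₀ c₁ + latPt G hexFrame a + G (hcpShift + ξ)} ∧ Wh G)) ∧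
    ∀ a, z₁ a - z₁ c₁ = b (z₀ a - z₀ c₁)

variable {Wf Wh Wf' Wh' : (E3 →L[ℝ] E3) → Prop} {𝓑 𝓑' : Set (E3 → E3)} {R : ℝ} {M : ℕ} {z₁ : Fin M → E3} {c₁ : Fin M}

/-- A windowed bent ball is a bent ball (forget the window). [formal bookkeeping] -/
theorem isBentBall_of_isWindowBall (h : IsWindowBall Wf Wh 𝓑 R z₁ c₁) : IsBentBall 𝓑 R z₁ c₁ := by
  obtain ⟨b, z₀, G, ξ, hb, hG, hξ, hbr, hbent⟩ := h
  refine ⟨b, z₀, hb, ⟨G, ξ, hG, hξ, ?_⟩, hbent⟩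
  rcases hbr with ⟨hr, _⟩ | ⟨hr, _⟩
  · exact Or.inl hr
  · exact Or.inr hr

/-- EXACTNESS: with TRIVIAL windows the windowed bent ball IS the bent ball — the two window predicates are the only content added. [formal bookkeeping] -/
theorem isWindowBall_top_of_isBentBall (h : IsBentBall 𝓑 R z₁ c₁) : IsWindowBall (fun _ => True) (fun _ => True) 𝓑 R z₁ c₁ := by
  obtain ⟨b, z₀, hb, ⟨G, ξ, hG, hξ, hr⟩, hbent⟩ := h
  refine ⟨b, z₀, G, ξ, hb, hG, hξ, ?_, hbent⟩
  rcases hr with hr | hr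
  · exact Or.inl ⟨hr, trivial⟩
  · exact Or.inr ⟨hr, trivial⟩

/-- The windowed bent ball is MONOTONE in both windows. [formal bookkeeping] -/
theorem isWindowBall_mono (hf : ∀ G, Wf G → Wf' G) (hh : ∀ G, Wh G → Wh' G) (h : IsWindowBall Wf Wh 𝓑 R z₁ c₁) : IsWindowBall Wf' Wh' 𝓑 R z₁ c₁ := by
  obtain ⟨b, z₀, G, ξ, hb, hG, hξ, hbr, hbent⟩ := h
  refine ⟨b, z₀, G, ξ, hb, hG, hξ, ?_, hbent⟩
  rcases hbr with ⟨hr, hw⟩ | ⟨hr, hw⟩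
  · exact Or.inl ⟨hr, hf G hw⟩
  · exact Or.inr ⟨hr, hh G hw⟩

/-- EDITION 2: the windowed bent ball is MONOTONE in the bending class (a narrower class of bendings gives a sub-family). [formal bookkeeping] -/
theorem isWindowBall_mono_bends (h𝓑 : 𝓑 ⊆ 𝓑') (h : IsWindowBall Wf Wh 𝓑 R z₁ c₁) : IsWindowBall Wf Wh 𝓑' R z₁ c₁ := by
  obtain ⟨b, z₀, G, ξ, hb, hG, hξ, hbr, hbent⟩ := h
  exact ⟨b, z₀, G, ξ, h𝓑 hb, hG, hξ, hbr, hbent⟩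

/-- (piece) [route statement · this cell; NOT a literature fact] ★ **`ShearDoor d₁ η 𝓑 Wf Wh`** — the SHEAR-AWARE DOOR (sector 𝔇′ of SECTOR-95 re-dialled,
critic r1590 (E)): the g95 door `Door d₁ η` (a neighbour within `d₁`, an `η`-good centre) AND a bent-homogeneous presentation over the bending class `𝓑`
(EDITION 2: a PARAMETER — record `bends0`, or the census-narrowed `polyBends q₂′ q₃′` of row «STIFF-BENT-97»; edition 1 hard-wired `bends0`) whose generating
map lies in the fcc window `Wf` / the hcp window `Wh`.  Record shape: `ShearDoorGram` below; record instance: memo §3. -/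
def ShearDoor (d₁ η : ℝ) (𝓑 : Set (E3 → E3)) (Wf Wh : (E3 →L[ℝ] E3) → Prop) : ChartFam := fun M₀ z₀ c₀ =>
  Door d₁ η M₀ z₀ c₀ ∧ IsWindowBall Wf Wh 𝓑 (133 / 10) z₀ c₀

/-- (piece) [route statement · this cell; NOT a literature fact] ★ **`ShearDoorGram d₁ η 𝓑 ν μ δ νh μh δh`** — the record SHAPE of the shear-aware door over
the bending class `𝓑`: Gram windows at the door's scale `d₁` with SEPARATE fcc literals `(ν, μ, δ)` (cubic frame) and hcp literals `(νh, μh, δh)` (hexagonal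
Cartesian frame, `c ∥ e₃`; the fcc soft trigonal mode is the hexagonal `c/a` mode — an axis-3 dilation in the hcp frame — so `μh` is of the `δ` class). -/
def ShearDoorGram (d₁ η : ℝ) (𝓑 : Set (E3 → E3)) (ν μ δ νh μh δh : ℝ) : ChartFam :=
  ShearDoor d₁ η 𝓑 (GramWindow d₁ ν μ δ) (GramWindow d₁ νh μh δh)

variable {𝓘 : ChartFam} {d₁ d' η : ℝ}

/-- ★ The shear-aware door is a SUB-FAMILY of the g95 door: every sector theorem of …StiffDoor / …KernelCutSector applies to `𝓡 := ShearDoor …` verbatim.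
[formal bookkeeping] -/
theorem shearDoor_le_door : FamilyLE (ShearDoor d₁ η 𝓑 Wf Wh) (Door d₁ η) := fun _ _ _ h => h.1

/-- … inside any ambient family. [formal bookkeeping] -/
theorem famAnd_shearDoor_le : FamilyLE (famAnd 𝓘 (ShearDoor d₁ η 𝓑 Wf Wh)) (famAnd 𝓘 (Door d₁ η)) := fun _ _ _ h => ⟨h.1, h.2.1⟩

/-- The OLD band sits inside the NEW band: hosts evicted by the window join 𝔅 (census rows «E-BAND-SHEAR», «BAND-SUP»). [formal bookkeeping] -/
theorem band_le_shearBand : FamilyLE (famAndNot 𝓘 (Door d₁ η)) (famAndNot 𝓘 (ShearDoor d₁ η 𝓑 Wf Wh)) := fun _ _ _ h => ⟨h.1, fun hR => h.2 hR.1⟩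

/-- A shear-door host is dense at every larger threshold (the door lies in the cone side `Dense dA`, `d₁ < dA`). [formal bookkeeping] -/
theorem dense_of_shearDoor (h : d₁ < d') : FamilyLE (ShearDoor d₁ η 𝓑 Wf Wh) (Dense d') := fun M₀ z₀ c₀ hz => dense_of_door h M₀ z₀ c₀ hz.1

/-- A shear-door host has an `η`-good centre. [formal bookkeeping] -/
theorem goodAtScale_of_shearDoor {M₀ : ℕ} {z₀ : Fin M₀ → E3} {c₀ : Fin M₀} (h : ShearDoor d₁ η 𝓑 Wf Wh M₀ z₀ c₀) : GoodAtScale η (3 / 2) z₀ c₀ := h.1.2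

/-- A shear-door host is a bent-homogeneous ball over the door's bending class `𝓑` (the window forgotten). [formal bookkeeping] -/
theorem isBentBall_of_shearDoor {M₀ : ℕ} {z₀ : Fin M₀ → E3} {c₀ : Fin M₀} (h : ShearDoor d₁ η 𝓑 Wf Wh M₀ z₀ c₀) : IsBentBall 𝓑 (133 / 10) z₀ c₀ :=
  isBentBall_of_isWindowBall h.2

/-- The shear-aware door is MONOTONE in both windows. [formal bookkeeping] -/
theorem shearDoor_mono_window (hf : ∀ G, Wf G → Wf' G) (hh : ∀ G, Wh G → Wh' G) : FamilyLE (ShearDoor d₁ η 𝓑 Wf Wh) (ShearDoor d₁ η 𝓑 Wf' Wh') :=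
  fun _ _ _ h => ⟨h.1, isWindowBall_mono hf hh h.2⟩

/-- … record shape: monotone in the six window literals (`d₁ ≥ 0`, `ν, μ, νh, μh ≥ −1`). [formal bookkeeping] -/
theorem shearDoorGram_mono {ν ν' μ μ' δ δ' νh νh' μh μh' δh δh' : ℝ} (hd : 0 ≤ d₁) (hν₀ : -1 ≤ ν) (hμ₀ : -1 ≤ μ) (hνh₀ : -1 ≤ νh) (hμh₀ : -1 ≤ μh)
    (hν : ν ≤ ν') (hμ : μ ≤ μ') (hδ : δ ≤ δ') (hνh : νh ≤ νh') (hμh : μh ≤ μh') (hδh : δh ≤ δh') :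
    FamilyLE (ShearDoorGram d₁ η 𝓑 ν μ δ νh μh δh) (ShearDoorGram d₁ η 𝓑 ν' μ' δ' νh' μh' δh') :=
  shearDoor_mono_window (fun _ hG => gramWindow_mono hd hν₀ hμ₀ hν hμ hδ hG) (fun _ hG => gramWindow_mono hd hνh₀ hμh₀ hνh hμh hδh hG)

/-- EDITION 2: the shear-aware door is MONOTONE in the bending class — the door over a narrower class of bendings (`polyBends q₂′ q₃′ ⊆ bends0`) is a
sub-family, so every sector theorem instantiated at the wider door restricts. [formal bookkeeping] -/
theorem shearDoor_mono_bends (h𝓑 : 𝓑 ⊆ 𝓑') : FamilyLE (ShearDoor d₁ η 𝓑 Wf Wh) (ShearDoor d₁ η 𝓑' Wf Wh) :=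
  fun _ _ _ h => ⟨h.1, isWindowBall_mono_bends h𝓑 h.2⟩

/-- EDITION 2: … so the band of the WIDER class sits inside the band of the NARROWER one — hosts evicted by narrowing `𝓑` join 𝔅 (census rows «E-BAND»,
«BAND-SUP» then include the strongly-bent dense hosts). [formal bookkeeping] -/
theorem shearBand_anti_bends (h𝓑 : 𝓑 ⊆ 𝓑') : FamilyLE (famAndNot 𝓘 (ShearDoor d₁ η 𝓑' Wf Wh)) (famAndNot 𝓘 (ShearDoor d₁ η 𝓑 Wf Wh)) :=
  fun M₀ z₀ c₀ h => ⟨h.1, fun hR => h.2 (shearDoor_mono_bends h𝓑 M₀ z₀ c₀ hR)⟩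

variable {H : HessTab} {Rb Λ₀ ηc : ℝ}

/-- ★ THE RECORD-SIDE READING, inherited: «DOOR-STIFF-97» `FamilyLE (famAnd 𝓘 (ShearDoor …)) (Stiff H R Λ₀)` puts the shear-aware door on the record side
`Stiff ∨ Deep` of g95 (`door_le_recordSide` pattern). [formal bookkeeping] -/
theorem shearDoor_le_recordSide (h : FamilyLE (famAnd 𝓘 (ShearDoor d₁ η 𝓑 Wf Wh)) (Stiff H Rb Λ₀)) :
    FamilyLE (famAnd 𝓘 (ShearDoor d₁ η 𝓑 Wf Wh)) (RecordSide H Rb Λ₀ ηc) := fun M₀ z₀ c₀ hz => recordSide_of_stiff M₀ z₀ c₀ (h M₀ z₀ c₀ hz)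

/-- «DOOR-STIFF» is ANTITONE in the window: certified on a wider window, it holds on every narrower one (so the census may certify a box cover ⊇
the instance window). [formal bookkeeping] -/
theorem doorStiff_anti_window (hf : ∀ G, Wf G → Wf' G) (hh : ∀ G, Wh G → Wh' G) (h : FamilyLE (famAnd 𝓘 (ShearDoor d₁ η 𝓑 Wf' Wh')) (Stiff H Rb Λ₀)) :
    FamilyLE (famAnd 𝓘 (ShearDoor d₁ η 𝓑 Wf Wh)) (Stiff H Rb Λ₀) := fun M₀ z₀ c₀ hz => h M₀ z₀ c₀ ⟨hz.1, shearDoor_mono_window hf hh M₀ z₀ c₀ hz.2⟩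

/-- … and in `Λ₀`. [formal bookkeeping] -/
theorem doorStiff_anti_lambda {Λ₁ : ℝ} (hΛ : Λ₀ ≤ Λ₁) (h : FamilyLE (famAnd 𝓘 (ShearDoor d₁ η 𝓑 Wf Wh)) (Stiff H Rb Λ₁)) :
    FamilyLE (famAnd 𝓘 (ShearDoor d₁ η 𝓑 Wf Wh)) (Stiff H Rb Λ₀) := fun M₀ z₀ c₀ hz => stiff_anti hΛ M₀ z₀ c₀ (h M₀ z₀ c₀ hz)

/-- EDITION 2: … and ANTITONE in the bending class: certified over a wider class `𝓑'`, «DOOR-STIFF» holds over every narrower `𝓑 ⊆ 𝓑'`. [formal bookkeeping] -/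
theorem doorStiff_anti_bends (h𝓑 : 𝓑 ⊆ 𝓑') (h : FamilyLE (famAnd 𝓘 (ShearDoor d₁ η 𝓑' Wf Wh)) (Stiff H Rb Λ₀)) :
    FamilyLE (famAnd 𝓘 (ShearDoor d₁ η 𝓑 Wf Wh)) (Stiff H Rb Λ₀) := fun M₀ z₀ c₀ hz => h M₀ z₀ c₀ ⟨hz.1, shearDoor_mono_bends h𝓑 M₀ z₀ c₀ hz.2⟩

end Door

end Summit.AtomisticToContinuum.Crystallization.Theorems.FrustratedLawDichotomyStrainedPatchShearDoor
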